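import Literature.NumberTheory.IwasawaTheory.Greenberg2016.CompactDualSelmer
import Literature.NumberTheory.IwasawaTheory.Greenberg2016.GlobalToLocalSurjectivity
import Literature.NumberTheory.GaloisRepresentations.TateDualLimitLocalPairingEndomorphism
import Literature.NumberTheory.GaloisRepresentations.ContinuousCohomologyDivisibleSequence
import HarnessLib

/-!
# Greenberg 2010 Prop. 3.2.1 (c), ASSEMBLY SKELETON: SUR(𝐃, 𝓛) from the dual Selmer inputs
# (`S_{𝓛*}/Ш¹*` torsion, `Ш¹*` torsion, `S_{𝓛*} = 0 ⇒ SUR`), discharging Prop. 2.3.2 itself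

Topic `NumberTheory/IwasawaTheory/Greenberg2016`; namespace
`Literature.NumberTheory.IwasawaTheory.Greenberg2016`. THEOREMS ONLY (no definition, no named fact, no
`sorry`, no instance). Seat `bsd-line-x1-p1-w4` gen 18 (prover, width seat of cell `bsd-eis`), brick
C7-skeleton of the road memo «SUR-Λ» (crux `GoodLatticeBDPValue`, stmt-BirchSwinnertonDyer-19032; target
`prop263_sur_of_crk_caseC_tc`).

PRINT (R. Greenberg, Kyoto J. Math. 50 (2010), proof of Prop. 3.2.1, p. 15 L27–32): "By proposition
3.1.1, and the assumption about the cokernel of `φ_𝓛`, it follows that `S_{𝓛*}(K, T*)` is a torsion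
`Λ`-module. … if assumption (c) is satisfied, then proposition 2.3.2 implies that `S_{𝓛*}(K, T*)`
vanishes. In all three cases, proposition 3.1.1 implies that `coker(φ_𝓛) = 0`."  This file is the
ASSEMBLY of that paragraph in the tree's Λ-adic currency (`T* = lim_k Hom(𝐃[𝔪ᵏ], μ_{p^k})`,
`CompactTateDual.lean`; `S_{𝓛*}(K, T*) = dualSelmer`, `Ш¹(K, Σ, T*) = dualSha`, the scalars
`θ̂_r = scalarDualEndHom`, `CompactDualSelmer.lean`), with the three inputs not yet in the tree taken as
EXPLICIT HYPOTHESES of the stated shape — so that the road's remaining bricks have fixed targets: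

* (T-C5) `hC5 : ∀ y ∈ S_{𝓛*}, ∃ r ≠ 0, H¹(θ̂_r) y ∈ Ш¹*` — Prop. 3.1.1 (easy half: `S_{𝓛*}/Ш¹* ↪ coker(φ_𝓛)^∨`)
  with CRK(𝐃, 𝓛) ("the assumption about the cokernel", `CotorsionCokernelOfCorank.lean`);
* (T-D) `hSha : ∀ y ∈ Ш¹*, ∃ r ≠ 0, H¹(θ̂_r) y = 0` — LEO(𝐃) and the Poitou–Tate pairing (6)
  (`Ш¹(K, Σ, T*)` is `Λ`-torsion);
* (T-C6) `hC6 : S_{𝓛*} = 0 → SUR(𝐃, 𝓛)` — Prop. 3.1.1's consequence "if `S_{𝓛*}(K, T*) = 0`, then `φ_𝓛`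
  is surjective".
DISCHARGED HERE (case (c): `η ∈ Σ` with `H⁰(K_η, T*) = 0` and `Q_𝓛(K_η, 𝐃)` divisible):
* `exists_sub_scalar_mem_localConditionGal` — `Q_𝓛(K_η, 𝐃)` `Λ`-divisible ⟹ every class of
  `H¹(Γ_{K_η}, 𝐃)` is `r·t' + l` with `l ∈ L(K_η, 𝐃)` (`r ≠ 0`), through the bridge `localHAddEquiv`
  (`Hmap_localHAddEquiv`, `cohomologyMap_eq_smul_of_forall`);
* **`eq_zero_of_mem_dualSelmer_of_scalar_eq_zero`** — Prop. 2.3.2 for `S_{𝓛*}`: `y ∈ S_{𝓛*}`, `r ≠ 0`,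
  `H¹(θ̂_r) y = 0` ⟹ `y = 0` (the tree's `eq_zero_of_cohomologyMap_dualEndHom_eq_zero_of_locDual_mem`
  with `θ := r·`, `h0` from `LOC1` (`eq_zero_of_LOC1`), `hbal` = `limitPairing_cohomologyMap_end`);
* **`dualSelmer_eq_bot_of_inputs`** — `S_{𝓛*}(K, T*) = 0` from (T-C5), (T-D) and the above;
* **`Specification.sur_of_dualSelmer_inputs`** — SUR(𝐃, 𝓛) from (T-C5), (T-D), (T-C6).

HONESTY. Conditional assembly (three explicit hypotheses); nothing here proves Prop. 3.2.1 outright, nor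
any summit statement; BSD is not advanced. AI-typed, kernel-checked.

## References
* R. Greenberg, *Surjectivity of the global-to-local map defining a Selmer group*, Kyoto J. Math. 50
  (2010) 853–888, Prop. 3.2.1 and proof (p. 15 L21–32), Prop. 3.1.1 (p. 14), Prop. 2.3.2 (p. 13),
  Prop. 2.1.1 (pp. 7–8), §2 p. 6. [Greenberg2010]
* R. Greenberg, *On the structure of Selmer groups*, Springer PROMS 188 (2016), Prop. 2.6.3 (p. 10).
  [Greenberg2016Selmer]
-/

noncomputable section

open scoped Classical
open Function CategoryTheory NumberField IsDedekindDomain Field IsLocalRing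
open _root_.TopRep _root_.ContRepresentation _root_.ContinuousCohomology
open Literature.NumberTheory.GaloisRepresentations
open Literature.NumberTheory.GaloisRepresentations.DiscreteGaloisModule
open Literature.NumberTheory.IwasawaTheory.Greenberg2006
open Literature.NumberTheory.GaloisCohomology (LocalInvariants)

namespace Literature.NumberTheory.IwasawaTheory.Greenberg2016

variable {K : Type} [Field K] [NumberField K] {S : Set (HeightOneSpectrum (𝓞 K))}
  {Λ : Type} [CommRing Λ] [TopologicalSpace Λ]
  {D : Type} [AddCommGroup D] [Module Λ D] [TopologicalSpace D] [DiscreteTopology D]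
  [ContinuousSMul Λ D]
  (ρ : ContinuousRep (GaloisGroupUnramifiedOutside K S) Λ D)
  {p : ℕ} [Fact p.Prime] {m : ℕ} [IsLocalRing Λ]
  (e : Λ ≃+* MvPowerSeries (Fin m) ℤ_[p]) (hD : IsCofinitelyGenerated Λ D)
  (inv : ∀ k : ℕ, LocalInvariants K (p ^ k)) (L : Specification S ρ)

omit [TopologicalSpace Λ] [IsLocalRing Λ] in
/-- `ℤ_p⟦T₁,…,T_m⟧` is a domain, and so is any ring isomorphic to it. [folklore] -/
private theorem isDomain_of_ringEquiv_mvPowerSeries' (e' : Λ ≃+* MvPowerSeries (Fin m) ℤ_[p]) :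
    IsDomain Λ := by
  haveI : IsDomain (MvPowerSeries (Fin m) ℤ_[p]) := NoZeroDivisors.to_isDomain _
  exact MulEquiv.isDomain _ e'.toMulEquiv

/-! ### The scalar `r` on `H¹(Γ_{K_v}, 𝐃)` (Γ_K side) and the divisibility of `Q_𝓛(K_η, 𝐃)` -/

omit [NumberField K] [ContinuousSMul Λ D] [IsLocalRing Λ] in
/-- The scalar `r ∈ Λ` commutes with `G_{K,Σ}` on `𝐃` (for `toGaloisModuleLocalHom`).
[cite: Greenberg2010, §2 p. 6 L5–8] -/
theorem lsmul_comm (r : Λ) (g : GaloisGroupUnramifiedOutside K S) (d : D) :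
    (⟨LinearMap.lsmul Λ D r, continuous_of_discreteTopology⟩ : D →L[Λ] D) (ρ g d) =
      ρ g ((⟨LinearMap.lsmul Λ D r, continuous_of_discreteTopology⟩ : D →L[Λ] D) d) := by
  change r • ρ g d = ρ g (r • d)
  rw [map_smul]

omit [IsLocalRing Λ] in
/-- **The scalar `r` on the local class group `H¹(Γ_{K_v}, 𝐃)`** (Γ_K side), as `H¹` of the
intertwining map `d ↦ r·d` (B2's `toGaloisModuleLocalHom`). [cite: Greenberg2010, §2 p. 6 L5–8] -/
theorem localHAddEquiv_map_lsmul (r : Λ) (v : Place K)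
    (t : galoisCohomology ((toGaloisModule S ρ).toLocal v) 1) :
    localHAddEquiv S ρ v 1
        (galoisCohomology.map (toGaloisModuleLocalHom S ρ ρ
          ⟨LinearMap.lsmul Λ D r, continuous_of_discreteTopology⟩ (lsmul_comm ρ r) v) 1 t) =
      r • localHAddEquiv S ρ v 1 t := by
  have h1 := Hmap_localHAddEquiv S ρ ρ ⟨LinearMap.lsmul Λ D r, continuous_of_discreteTopology⟩
    (lsmul_comm ρ r) v 1 t
  -- `Hmap(r·) = r·` on `H¹(K_v, 𝐃)` (the `Λ`-structure of continuous cohomology is through the coefficients)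
  have h2 : (cohomologyMap (TopRep.ofHom ⟨(⟨LinearMap.lsmul Λ D r, continuous_of_discreteTopology⟩ : D →L[Λ] D),
      fun g ↦ by ext d; exact lsmul_comm ρ r (localToUnramified S v g) d⟩ :
        (localRep S ρ v).toTopRep ⟶ (localRep S ρ v).toTopRep) 1).hom (localHAddEquiv S ρ v 1 t) =
      r • localHAddEquiv S ρ v 1 t :=
    (localRep S ρ v).cohomologyMap_eq_smul_of_forall r _ (fun _ => rfl) 1 _
  exact h1.symm.trans h2

omit [IsLocalRing Λ] in
/-- **`Q_𝓛(K_η, 𝐃)` `Λ`-divisible ⟹ every class `t ∈ H¹(Γ_{K_η}, 𝐃)` is `r·t' + l` with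
`l ∈ L(K_η, 𝐃)`** (`r ≠ 0`), on the Γ_K side (the hypothesis `hdiv` of the tree's Prop. 2.3.2,
`eq_zero_of_cohomologyMap_dualEndHom_eq_zero_of_locDual_mem`). [cite: Greenberg2010, Prop. 2.3.2 (p. 13 L29–31)] -/
theorem exists_sub_scalar_mem_localConditionGal (v : Place K) (hQ : IsDivisible Λ (L.Q v))
    {r : Λ} (hr : r ≠ 0) (t : galoisCohomology ((toGaloisModule S ρ).toLocal v) 1) :
    ∃ t' l, l ∈ localConditionGal ρ L v ∧
      t = galoisCohomology.map (toGaloisModuleLocalHom S ρ ρ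
        ⟨LinearMap.lsmul Λ D r, continuous_of_discreteTopology⟩ (lsmul_comm ρ r) v) 1 t' + l := by
  obtain ⟨q, hq⟩ := hQ r hr (Submodule.Quotient.mk (localHAddEquiv S ρ v 1 t))
  obtain ⟨c', rfl⟩ := Submodule.Quotient.mk_surjective (L v) q
  have hmem : localHAddEquiv S ρ v 1 t - r • c' ∈ L v := by
    rw [← Submodule.Quotient.eq, Submodule.Quotient.mk_smul]
    exact hq.symm
  refine ⟨(localHAddEquiv S ρ v 1).symm c', t - galoisCohomology.map (toGaloisModuleLocalHom S ρ ρ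
      ⟨LinearMap.lsmul Λ D r, continuous_of_discreteTopology⟩ (lsmul_comm ρ r) v) 1
        ((localHAddEquiv S ρ v 1).symm c'), ?_, by abel⟩
  rw [mem_localConditionGal_iff, map_sub, localHAddEquiv_map_lsmul, AddEquiv.apply_symm_apply]
  exact hmem

/-! ### Prop. 2.3.2 for `S_{𝓛*}(K, T*)` -/

variable {L inv}

/-- **Greenberg 2010 Prop. 2.3.2 on `S_{𝓛*}(K, T*)`, case (c) data at `η`**: if `𝐃` is `Λ`-divisible,
`η ∈ Σ` satisfies LOC⁽¹⁾ (`H⁰(K_η, T*) = 0`) and `Q_𝓛(K_η, 𝐃)` is divisible, and the level pairings at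
`η` are perfect with the level-change law, then a class `y ∈ S_{𝓛*}(K, T*)` killed by a non-zero scalar
(`H¹(θ̂_r) y = 0`, `r ≠ 0`) is `0` ("`S_{𝓛*}(K, T*)_{Λ-tors} = 0`").
[cite: Greenberg2010, Prop. 2.3.2 (p. 13 L26–38)] -/
theorem eq_zero_of_mem_dualSelmer_of_scalar_eq_zero (hdiv : IsDivisible Λ D)
    {η : HeightOneSpectrum (𝓞 K)} (hηS : η ∈ S) (hLOC1 : LOC1 S ρ (Sum.inr η))
    (hQ : IsDivisible Λ (L.Q (Sum.inr η))) (hinv : TorsionLayers.InvLevelLaw inv (Sum.inr η : Place K))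
    (hperf : ∀ k, (inv k).IsPerfect)
    {y : continuousCohomology 1 (torsionLayers ρ e hD).dualSystem.limitRep.toTopRep}
    (hy : y ∈ dualSelmer ρ e hD inv L) {r : Λ} (hr : r ≠ 0)
    (h : cohomologyMap (scalarDualEndHom ρ e hD r) 1 y = 0) : y = 0 := by
  haveI : NeZero p := ⟨(Fact.out : p.Prime).ne_zero⟩
  -- `θ = r·` on `𝐃`: layer-preserving, `Γ_K`-equivariant, surjective (`𝐃` divisible)
  have hs : Surjective (DistribSMul.toAddMonoidHom D r) := fun d => hdiv r hr d
  -- (i): `(T*)^{Γ_{K_η}} = 0` from `LOC1`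
  have h0 := eq_zero_of_LOC1 ρ (torsionLayers ρ e hD) (Sum.inr η) hLOC1
  -- the scalar on `H¹(Γ_{K_η}, 𝐃)` (Γ_K side) and the balance `⟪r t, z⟫ = ⟪t, r̂ z⟫`
  let ΘI := toGaloisModuleLocalHom S ρ ρ ⟨LinearMap.lsmul Λ D r, continuous_of_discreteTopology⟩
    (lsmul_comm ρ r) (Sum.inr η)
  have hbal : ∀ t z, (torsionLayers ρ e hD).limitPairing inv (Sum.inr η) hinv (galoisCohomology.map ΘI 1 t) z =
      (torsionLayers ρ e hD).limitPairing inv (Sum.inr η) hinv t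
        (cohomologyMap ((torsionLayers ρ e hD).dualEndHomComap
          (absGaloisRestrict K (Place.Completion (Sum.inr η : Place K)))
          (DistribSMul.toAddMonoidHom D r) (fun k d hd => smul_mem_torsionLayers ρ e hD k r d hd)
          (smul_toDiscreteGaloisModule_comm ρ r)) 1 z) := fun t z =>
    (torsionLayers ρ e hD).limitPairing_cohomologyMap_end (DistribSMul.toAddMonoidHom D r)
      (fun k d hd => smul_mem_torsionLayers ρ e hD k r d hd) inv (smul_toDiscreteGaloisModule_comm ρ r)
      (Sum.inr η) hinv (TopRep.ofHom ⟨ΘI.toContinuousLinearMap, ΘI.isIntertwining'⟩) (fun _ => rfl)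
      _ (fun _ => rfl) t z
  -- (ii): `Q_𝓛(K_η, 𝐃)` divisible, read on the Γ_K side
  have hdivT := exists_sub_scalar_mem_localConditionGal ρ L (Sum.inr η) hQ hr
  exact (torsionLayers ρ e hD).eq_zero_of_cohomologyMap_dualEndHom_eq_zero_of_locDual_mem
    (DistribSMul.toAddMonoidHom D r) (fun k d hd => smul_mem_torsionLayers ρ e hD k r d hd)
    (smul_toDiscreteGaloisModule_comm ρ r) inv hinv hperf hs h0 (galoisCohomology.map ΘI 1) hbal
    (localConditionGal ρ L (Sum.inr η)) hdivT y h (hy.1 (Sum.inr η) ((inSigma_inr_iff S η).2 hηS))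

/-! ### `S_{𝓛*}(K, T*) = 0` and SUR(𝐃, 𝓛) from the three inputs -/

/-- **`S_{𝓛*}(K, T*) = 0`** from (T-C5) `S_{𝓛*}/Ш¹*` is `Λ`-torsion, (T-D) `Ш¹*` is `Λ`-torsion, and
Prop. 2.3.2 (case (c) data at `η`): a torsion class of `S_{𝓛*}` is `0`, and every class is torsion
("it follows that `S_{𝓛*}(K, T*)` is a torsion `Λ`-module … proposition 2.3.2 implies that
`S_{𝓛*}(K, T*)` vanishes"). [cite: Greenberg2010, Prop. 3.2.1 proof (p. 15 L27–32)] -/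
theorem dualSelmer_eq_bot_of_inputs (hdiv : IsDivisible Λ D)
    {η : HeightOneSpectrum (𝓞 K)} (hηS : η ∈ S) (hLOC1 : LOC1 S ρ (Sum.inr η))
    (hQ : IsDivisible Λ (L.Q (Sum.inr η))) (hinv : TorsionLayers.InvLevelLaw inv (Sum.inr η : Place K))
    (hperf : ∀ k, (inv k).IsPerfect)
    (hC5 : ∀ y ∈ dualSelmer ρ e hD inv L, ∃ r : Λ, r ≠ 0 ∧
      cohomologyMap (scalarDualEndHom ρ e hD r) 1 y ∈ dualSha ρ e hD inv)
    (hSha : ∀ y ∈ dualSha ρ e hD inv, ∃ r : Λ, r ≠ 0 ∧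
      cohomologyMap (scalarDualEndHom ρ e hD r) 1 y = 0) :
    dualSelmer ρ e hD inv L = ⊥ := by
  haveI := isDomain_of_ringEquiv_mvPowerSeries' e
  rw [eq_bot_iff]
  intro y hy
  rw [AddSubgroup.mem_bot]
  obtain ⟨r, hr, hry⟩ := hC5 y hy
  obtain ⟨s, hs, hsry⟩ := hSha _ hry
  rw [cohomologyMap_scalarDualEndHom_comp] at hsry
  exact eq_zero_of_mem_dualSelmer_of_scalar_eq_zero ρ e hD hdiv hηS hLOC1 hQ hinv hperf hy
    (mul_ne_zero hr hs) hsry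

/-- **SUR(𝐃, 𝓛) in case (c) from the three dual-side inputs** (Greenberg 2010 Prop. 3.2.1 (c),
assembled): (T-C5) `S_{𝓛*}/Ш¹*` `Λ`-torsion, (T-D) `Ш¹*` `Λ`-torsion, (T-C6) `S_{𝓛*} = 0 ⇒ SUR`, with
`𝐃` divisible and the case-(c) data at `η` (LOC⁽¹⁾, `Q_𝓛(K_η, 𝐃)` divisible, perfect level pairings with
the level-change law). [cite: Greenberg2010, Prop. 3.2.1 (c) and proof (p. 15 L21–32)]
[cite: Greenberg2016Selmer, Prop. 2.6.3 (c) (p. 10)] -/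
theorem Specification.sur_of_dualSelmer_inputs (hdiv : IsDivisible Λ D)
    {η : HeightOneSpectrum (𝓞 K)} (hηS : η ∈ S) (hLOC1 : LOC1 S ρ (Sum.inr η))
    (hQ : IsDivisible Λ (L.Q (Sum.inr η))) (hinv : TorsionLayers.InvLevelLaw inv (Sum.inr η : Place K))
    (hperf : ∀ k, (inv k).IsPerfect)
    (hC5 : ∀ y ∈ dualSelmer ρ e hD inv L, ∃ r : Λ, r ≠ 0 ∧
      cohomologyMap (scalarDualEndHom ρ e hD r) 1 y ∈ dualSha ρ e hD inv)
    (hSha : ∀ y ∈ dualSha ρ e hD inv, ∃ r : Λ, r ≠ 0 ∧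
      cohomologyMap (scalarDualEndHom ρ e hD r) 1 y = 0)
    (hC6 : (∀ y ∈ dualSelmer ρ e hD inv L, y = 0) → L.SUR) : L.SUR :=
  hC6 fun y hy => by
    have h := dualSelmer_eq_bot_of_inputs ρ e hD hdiv hηS hLOC1 hQ hinv hperf hC5 hSha
    rw [h, AddSubgroup.mem_bot] at hy
    exact hy

end Literature.NumberTheory.IwasawaTheory.Greenberg2016

end
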